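import Mathlib

/-!
# `p`-CLASS DECOMPOSITION of formal power series: `k⟦X⟧ = ⊕_{κ ∈ (ℤ/p)^σ} k⟦X⟧_κ` by the residues of the exponents modulo `p`

Sub-problem `ResolutionOfSingularities`, DOOR crux `stmt-ResolutionOfSingularities-19897` (`HypersurfaceCentreConstruction`), re-entry object #1 of
CHAIN w43 v4.38 (the dominance word `TwoFlagDominanceAtLevelLE3Body p`): kernel infrastructure (F-3) for res-D-brk-1's FROBENIUS-CLASS argument
(`D/res-D-brk-1/O70B-JCAN-PLAN.md` §7–§8: «split every series by the residue class mod p of its exponents: `Ŝ = ⊕_κ Ŝ_κ`, `Ŝ_0 = K⟦x^p, v'^p, y'^p⟧`,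
classes multiply additively; p-th powers lie in `Ŝ_0`; a MONOMIAL ideal is class-graded»), dealt by res-L1-w43-plan-1 2026-08-27T22:08:38Z to
res-L1-w43-stub-1 g7.  [OURS · L1 W4.3 · chain w43.  Elementary bookkeeping on `MvPowerSeries`; nothing here is a statement of any manuscript;
AI-produced, gate-checked, weaker than expert review.  «[OURS · L1 W4.3] replaces the role of nothing printed; NOT a statement of the manuscript.»]

For a commutative ring `K`, a natural number `p` and an index type `σ`:
* `exponentClass p e : σ → ZMod p` — the residues of an exponent `e : σ →₀ ℕ`; additive (`exponentClass_add`), zero on `p`-multiples;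
* `pClassComponent p κ f` — the part of `f : MvPowerSeries σ K` carried by the exponents of class `κ` (`coeff_pClassComponent`);
  additive, `K`-linear in `f`, idempotent and orthogonal in `κ` (`pClassComponent_pClassComponent`), `Σ_κ f_κ = f` (`sum_pClassComponent`,
  `σ` finite, `p ≠ 0`), and **multiplicative grading** `(f g)_κ = Σ_{κ₁} f_{κ₁} g_{κ − κ₁}` (`pClassComponent_mul`).
Companions (proof lane): `…PClassMonomialIdeals` (monomial ideals are class-graded), `…PClassFrobenius` (`p`-th powers are of class `0`).
-/

set_option linter.dupNamespace false -- mandated namespace of this single-conjunct summit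

noncomputable section

namespace Summit.ResolutionOfSingularities.ResolutionOfSingularities.Theorems

namespace LocalEngine.Iota3.PClass

open MvPowerSeries

variable {σ : Type*} {K : Type*} [CommRing K]

/-! ## Classes of exponents -/

/-- THE CLASS OF AN EXPONENT modulo `p`: `e ↦ (e_i mod p)_i`. -/
def exponentClass (p : ℕ) (e : σ →₀ ℕ) : σ → ZMod p := fun i => (e i : ZMod p)

/-- Unfolding. -/
theorem exponentClass_apply (p : ℕ) (e : σ →₀ ℕ) (i : σ) : exponentClass p e i = (e i : ZMod p) := rfl

/-- Classes add. -/
theorem exponentClass_add (p : ℕ) (e e' : σ →₀ ℕ) : exponentClass p (e + e') = exponentClass p e + exponentClass p e' := by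
  funext i
  simp [exponentClass, Finsupp.add_apply, Nat.cast_add]

/-- The zero exponent has class `0`. -/
theorem exponentClass_zero (p : ℕ) : exponentClass p (0 : σ →₀ ℕ) = 0 := by
  funext i; simp [exponentClass]

/-- A `p`-multiple has class `0`. -/
theorem exponentClass_nsmul (p : ℕ) (e : σ →₀ ℕ) : exponentClass p (p • e) = 0 := by
  funext i
  simp [exponentClass, Finsupp.smul_apply]

/-- An exponent has class `0` iff all its entries are divisible by `p`. -/
theorem exponentClass_eq_zero_iff (p : ℕ) (e : σ →₀ ℕ) : exponentClass p e = 0 ↔ ∀ i, p ∣ e i := by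
  constructor
  · intro h i
    have := congrFun h i
    simp only [exponentClass, Pi.zero_apply] at this
    exact (ZMod.natCast_eq_zero_iff _ _).mp this
  · intro h
    funext i
    simp only [exponentClass, Pi.zero_apply]
    exact (ZMod.natCast_eq_zero_iff _ _).mpr (h i)

/-! ## Class components -/

open Classical in
/-- THE `p`-CLASS COMPONENT of a series: keep the coefficients whose exponent has class `κ`. -/
def pClassComponent (p : ℕ) (κ : σ → ZMod p) (f : MvPowerSeries σ K) : MvPowerSeries σ K :=
  fun e => if exponentClass p e = κ then coeff e f else 0

open Classical in
/-- Coefficients of a class component. -/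
theorem coeff_pClassComponent (p : ℕ) (κ : σ → ZMod p) (f : MvPowerSeries σ K) (e : σ →₀ ℕ) :
    coeff e (pClassComponent p κ f) = if exponentClass p e = κ then coeff e f else 0 := rfl

/-- Coefficients in the class. -/
theorem coeff_pClassComponent_of_eq {p : ℕ} {κ : σ → ZMod p} {e : σ →₀ ℕ} (h : exponentClass p e = κ) (f : MvPowerSeries σ K) :
    coeff e (pClassComponent p κ f) = coeff e f := by
  rw [coeff_pClassComponent, if_pos h]

/-- Coefficients outside the class vanish. -/
theorem coeff_pClassComponent_of_ne {p : ℕ} {κ : σ → ZMod p} {e : σ →₀ ℕ} (h : exponentClass p e ≠ κ) (f : MvPowerSeries σ K) :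
    coeff e (pClassComponent p κ f) = 0 := by
  rw [coeff_pClassComponent, if_neg h]

/-- Class components are additive. -/
theorem pClassComponent_add (p : ℕ) (κ : σ → ZMod p) (f g : MvPowerSeries σ K) :
    pClassComponent p κ (f + g) = pClassComponent p κ f + pClassComponent p κ g := by
  classical
  ext e
  simp only [coeff_pClassComponent, map_add]
  split_ifs <;> simp

/-- Class components of zero. -/
theorem pClassComponent_zero (p : ℕ) (κ : σ → ZMod p) : pClassComponent p κ (0 : MvPowerSeries σ K) = 0 := by
  classical
  ext e
  simp only [coeff_pClassComponent, map_zero, ite_self]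

/-- Class components commute with scalars. -/
theorem pClassComponent_C_mul (p : ℕ) (κ : σ → ZMod p) (c : K) (f : MvPowerSeries σ K) :
    pClassComponent p κ (C c * f) = C c * pClassComponent p κ f := by
  classical
  ext e
  simp only [coeff_pClassComponent, coeff_C_mul]
  split_ifs <;> simp

/-- Class components of a negation. -/
theorem pClassComponent_neg (p : ℕ) (κ : σ → ZMod p) (f : MvPowerSeries σ K) :
    pClassComponent p κ (-f) = -pClassComponent p κ f := by
  classical
  ext e
  simp only [coeff_pClassComponent, map_neg]
  split_ifs <;> simp

/-- Class components of a finite sum. -/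
theorem pClassComponent_sum (p : ℕ) (κ : σ → ZMod p) {ι : Type*} (s : Finset ι) (f : ι → MvPowerSeries σ K) :
    pClassComponent p κ (∑ i ∈ s, f i) = ∑ i ∈ s, pClassComponent p κ (f i) := by
  classical
  induction s using Finset.induction_on with
  | empty => simp [pClassComponent_zero]
  | insert a s ha ih => rw [Finset.sum_insert ha, Finset.sum_insert ha, pClassComponent_add, ih]

open Classical in
/-- The class components are orthogonal idempotents. -/
theorem pClassComponent_pClassComponent (p : ℕ) (κ κ' : σ → ZMod p) (f : MvPowerSeries σ K) :
    pClassComponent p κ (pClassComponent p κ' f) = if κ = κ' then pClassComponent p κ f else 0 := by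
  ext e
  by_cases h : κ = κ'
  · subst h
    rw [if_pos rfl, coeff_pClassComponent, coeff_pClassComponent]
    split_ifs <;> rfl
  · rw [if_neg h, map_zero, coeff_pClassComponent, coeff_pClassComponent]
    split_ifs with h1 h2
    · exact absurd (h1.symm.trans h2) h
    · rfl
    · rfl

open Classical in
/-- A monomial is its own component in the class of its exponent, and has no other components. -/
theorem pClassComponent_monomial (p : ℕ) (κ : σ → ZMod p) (e : σ →₀ ℕ) (c : K) :
    pClassComponent p κ (monomial e c) = if exponentClass p e = κ then monomial e c else 0 := by
  ext e'
  rw [coeff_pClassComponent, coeff_monomial]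
  by_cases h1 : e' = e
  · subst h1
    rw [if_pos rfl]
    split_ifs with h2
    · rw [coeff_monomial, if_pos rfl]
    · rw [map_zero]
  · rw [if_neg h1, ite_self]
    split_ifs
    · rw [coeff_monomial, if_neg h1]
    · rw [map_zero]

/-- A series all of whose exponents have class `κ` is its own `κ`-component. -/
theorem pClassComponent_eq_self {p : ℕ} {κ : σ → ZMod p} {f : MvPowerSeries σ K} (h : ∀ e, coeff e f ≠ 0 → exponentClass p e = κ) :
    pClassComponent p κ f = f := by
  classical
  ext e
  rw [coeff_pClassComponent]
  split_ifs with he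
  · rfl
  · by_contra hne
    exact he (h e (Ne.symm hne))

/-- A series none of whose exponents has class `κ` has zero `κ`-component. -/
theorem pClassComponent_eq_zero {p : ℕ} {κ : σ → ZMod p} {f : MvPowerSeries σ K} (h : ∀ e, exponentClass p e = κ → coeff e f = 0) :
    pClassComponent p κ f = 0 := by
  classical
  ext e
  rw [coeff_pClassComponent, map_zero]
  split_ifs with he
  · exact h e he
  · rfl

/-- The component vanishes iff no exponent of the class occurs. -/
theorem pClassComponent_eq_zero_iff {p : ℕ} {κ : σ → ZMod p} {f : MvPowerSeries σ K} :
    pClassComponent p κ f = 0 ↔ ∀ e, exponentClass p e = κ → coeff e f = 0 := by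
  refine ⟨fun h e he => ?_, pClassComponent_eq_zero⟩
  have := congrArg (coeff e) h
  rwa [coeff_pClassComponent_of_eq he, map_zero] at this

/-! ## The decomposition `f = Σ_κ f_κ` (finitely many classes: `σ` finite, `p ≠ 0`) -/

/-- **`f = Σ_κ f_κ`.** -/
theorem sum_pClassComponent [Fintype σ] [DecidableEq σ] (p : ℕ) [NeZero p] (f : MvPowerSeries σ K) :
    ∑ κ : σ → ZMod p, pClassComponent p κ f = f := by
  classical
  ext e
  rw [map_sum]
  simp only [coeff_pClassComponent]
  refine (Finset.sum_eq_single (exponentClass p e) (fun κ _ hκ => ?_) (fun h => absurd (Finset.mem_univ _) h)).trans ?_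
  · rw [if_neg (Ne.symm hκ)]
  · rw [if_pos rfl]

/-! ## Multiplicativity: classes add under products -/

/-- **THE CLASS COMPONENTS ARE A GRADING**: `(f g)_κ = Σ_{κ₁} f_{κ₁} · g_{κ − κ₁}`. -/
theorem pClassComponent_mul [Fintype σ] [DecidableEq σ] (p : ℕ) [NeZero p] (κ : σ → ZMod p) (f g : MvPowerSeries σ K) :
    pClassComponent p κ (f * g) = ∑ κ₁ : σ → ZMod p, pClassComponent p κ₁ f * pClassComponent p (κ - κ₁) g := by
  classical
  ext e
  rw [coeff_pClassComponent, map_sum]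
  simp only [coeff_mul, coeff_pClassComponent]
  rw [Finset.sum_comm]
  -- for each pair `(a, b)` with `a + b = e`, exactly one class `κ₁ = class a` contributes, and only if `class e = κ`
  have hL : (if exponentClass p e = κ then ∑ ab ∈ Finset.HasAntidiagonal.antidiagonal e, coeff ab.1 f * coeff ab.2 g else 0) =
      ∑ ab ∈ Finset.HasAntidiagonal.antidiagonal e, (if exponentClass p e = κ then coeff ab.1 f * coeff ab.2 g else 0) := by
    split_ifs
    · rfl
    · exact Finset.sum_const_zero.symm
  refine hL.trans (Finset.sum_congr rfl fun ab hab => ?_)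
  rw [Finset.HasAntidiagonal.mem_antidiagonal] at hab
  have hcl : exponentClass p e = exponentClass p ab.1 + exponentClass p ab.2 := by rw [← hab, exponentClass_add]
  refine ((Finset.sum_eq_single (exponentClass p ab.1) (fun κ₁ _ hne => ?_) (fun h => absurd (Finset.mem_univ _) h)).trans ?_).symm
  · rw [if_neg (Ne.symm hne), zero_mul]
  · rw [if_pos rfl]
    by_cases h : exponentClass p e = κ
    · rw [if_pos h, if_pos]
      rw [← h, hcl, add_sub_cancel_left]
    · rw [if_neg h, if_neg, mul_zero]
      intro h2
      apply h
      rw [hcl, h2, add_sub_cancel]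

/-- Products of pure classes are pure: if all exponents of `f` have class `κ₁` and those of `g` class `κ₂`, those of `f g` have class `κ₁ + κ₂`. -/
theorem pClassComponent_mul_of_pure [Fintype σ] [DecidableEq σ] {p : ℕ} [NeZero p] {κ₁ κ₂ : σ → ZMod p} {f g : MvPowerSeries σ K}
    (hf : pClassComponent p κ₁ f = f) (hg : pClassComponent p κ₂ g = g) :
    pClassComponent p (κ₁ + κ₂) (f * g) = f * g := by
  classical
  rw [pClassComponent_mul, Finset.sum_eq_single κ₁]
  · rw [add_sub_cancel_left, hf, hg]
  · intro κ _ hne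
    have h1 : pClassComponent p κ f = 0 := by
      rw [← hf, pClassComponent_pClassComponent, if_neg hne]
    rw [h1, zero_mul]
  · exact fun h => absurd (Finset.mem_univ _) h

end LocalEngine.Iota3.PClass

end Summit.ResolutionOfSingularities.ResolutionOfSingularities.Theorems

end
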